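import Literature.NumberTheory.Sieve.HeathBrownCubicNuSum
import Literature.NumberTheory.Sieve.HeathBrownCubicLemma45
import HarnessLib

/-!
# Heath-Brown's Lemma 4.7: `∑_{|m| ≤ x, |n| ≤ y} τ(m + n·2^{1/3})^A ≪ xy (log xy)^{c(A)}`

Pure-proof file (no definitions, no named facts) in the decomposition of **Heath-Brown's Type II
estimate, Lemma 3.10** (`HeathBrown2001_lemma_3_10` of `HeathBrownCubicTypeII`), D. R. Heath-Brown,
*Primes represented by `x³ + 2y³`*, Acta Math. 186 (2001), 1–84.  **Lemma 4.7** (p. 25): "Let `x, y ≥ 2`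
be given. Then for any positive integer `A` there exists a positive constant `c(A)` such that
`∑_{|m| ≤ x, |n| ≤ y} τ(m + n·2^{1/3})^A ≪ xy (log xy)^{c(A)}`" — "a corollary of Lemma 4.6" (the case
`α = 1`, `β = 2^{1/3}`).  It is used in §11 (the error `E_V`, (11.2), and the diagonal terms `S₁`, p. 68).

Printed route (proof of Lemma 4.6, p. 24): by Lemma 4.4, `τ(m + nβ)^A ≪ τ(I)^{c}` for some `I ∣ m + nβ`
with `N(I) ≪ z`; "we now write `ν(J)` for the smallest rational multiple of the ideal `J` … each such value
of `n` will determine `m` to modulus `I₂` [here `I`] … there are `O(xν(I)⁻¹)` [`+ O(1)`] possible values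
of `m` corresponding to each `n`", and the resulting `∑_I τ(I)^c/ν(I)` is `≪ (log x)^c`.  This file PROVES
the lemma this way from the tree's pieces: Lemma 4.4 (`HeathBrown2001_lemma_4_4`, with `n = 12` since
`N(m + nθ) ≤ 64(|m|+|n|)³ ≤ X^{12}`), the residue-class count `card_Ioc_filter_modEq_le`, the `ν`-weighted
divisor sum `exists_sum_nuWeight_le` (`HeathBrownCubicNuSum`) and Lemma 4.2 over `K`
(`exists_sum_idealDivisorCount_pow_le`):

* `card_filter_intCast_add_mul_mem_le` — for fixed `n`, `#{|m| ≤ X : m + nθ ∈ J} ≤ 2X/ν(J) + 1`;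
* `card_box_filter_mem_le` — `#{|m| ≤ X, |n| ≤ Y : m + nθ ∈ J} ≤ (2Y+1)(2X/ν(J) + 1)`;
* **`HeathBrown2001_lemma_4_7`** — for integers `2 ≤ Y ≤ X` (the roles of `x ≥ y` as in Lemma 4.6) and all
  `(m, n) ≠ (0, 0)` with `|m| ≤ X`, `|n| ≤ Y`: `∑ τ((m + nθ))^A ≤ C X Y (log XY)^e`.

## References

* D. R. Heath-Brown, *Primes represented by `x³ + 2y³`*, Acta Math. 186 (2001), 1–84: Lemmas 4.6, 4.7,
  pp. 24–25. [cite: HeathBrownActa2001, Lemma 4.7]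

## Mathlib / tree search

Tree: `HeathBrownCubicNuSum` (`idealNu`, `intCast_mem_iff_idealNu_dvd`, `idealNu_pos`,
`exists_sum_nuWeight_le`), `HeathBrownCubicLemma45` (`absNorm_span_coordElt_le`), `HeathBrownCubicLemma44`
(`HeathBrown2001_lemma_4_4`), `HeathBrownCubicLatticeCount` (`card_Ioc_filter_modEq_le`, `coordElt_injective`),
`HeathBrownCubicSieveSetupProofs` (`exists_sum_idealDivisorCount_pow_le`). Mathlib:
`Finset.card_eq_sum_card_fiberwise`, `Finset.card_le_card_of_injOn`, `Ideal.dvd_span_singleton`.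
-/

noncomputable section

open Polynomial NumberField Finset

namespace Literature.NumberTheory.Sieve.CubicSieve

open LFunctions.CubeRootTwoField CubicPrimes

/-! ### Counting `m + nθ ∈ J` in a box -/

open scoped Classical in
/-- For fixed `n`, the integers `m ∈ [−X, X]` with `m + nθ ∈ J` lie in one residue class modulo `ν(J)`,
so there are at most `2X/ν(J) + 1` of them (`J ≠ 0`). [cite: HeathBrownActa2001, §4 p. 24] -/
theorem card_filter_intCast_add_mul_mem_le {J : Ideal (𝓞 K)} (hJ : J ≠ ⊥) (X : ℕ) (n : ℤ) :
    (#((Icc (-(X : ℤ)) X).filter (fun m : ℤ => (m : 𝓞 K) + (n : 𝓞 K) * θint ∈ J)) : ℝ) ≤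
      2 * X / idealNu J + 1 := by
  classical
  set F := (Icc (-(X : ℤ)) X).filter (fun m : ℤ => (m : 𝓞 K) + (n : 𝓞 K) * θint ∈ J) with hF
  have hν := idealNu_pos hJ
  have hν' : (0 : ℝ) < idealNu J := by exact_mod_cast hν
  rcases F.eq_empty_or_nonempty with h0 | ⟨m₀, hm₀⟩
  · rw [h0, card_empty, Nat.cast_zero]; positivity
  · have hm₀' := (mem_filter.mp hm₀).2
    -- `F ⊆ {m ∈ (−X−1, X] : m ≡ m₀ (mod ν)}`
    have hsub : F ⊆ (Ioc (-(X : ℤ) - 1) X).filter (fun m => m ≡ m₀ [ZMOD (idealNu J : ℕ)]) := by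
      intro m hm
      rw [hF, mem_filter, mem_Icc] at hm
      rw [mem_filter, mem_Ioc]
      refine ⟨⟨by omega, hm.1.2⟩, ?_⟩
      have hdiff : ((m - m₀ : ℤ) : 𝓞 K) ∈ J := by
        have := J.sub_mem hm.2 hm₀'
        push_cast
        convert this using 1
        ring
      have hdvd := (intCast_mem_iff_idealNu_dvd J _).mp hdiff
      exact (Int.modEq_iff_dvd.mpr (by
        have : ((idealNu J : ℕ) : ℤ) ∣ -(m - m₀) := (dvd_neg.mpr hdvd)
        rwa [neg_sub] at this)).symm
    have hcount := card_Ioc_filter_modEq_le (-(X : ℤ) - 1) X hν m₀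
    have harith : ((X : ℤ) - (-(X : ℤ) - 1) - 1) / (idealNu J : ℕ) + 1 =
        (2 * X : ℤ) / (idealNu J : ℕ) + 1 := by
      congr 1; congr 1; ring
    rw [harith] at hcount
    have h2 : (((2 * X : ℤ) / (idealNu J : ℕ) + 1).toNat : ℝ) ≤ 2 * X / idealNu J + 1 := by
      have hq0 : (0 : ℤ) ≤ (2 * X : ℤ) / (idealNu J : ℕ) := Int.ediv_nonneg (by positivity) (by positivity)
      rw [← Int.cast_natCast (R := ℝ), Int.toNat_of_nonneg (by linarith)]
      push_cast
      gcongr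
      -- `((2X) / ν : ℤ) ≤ 2X/ν` in `ℝ`
      have h3 : (((2 * X : ℤ) / (idealNu J : ℕ) : ℤ) : ℝ) * idealNu J ≤ 2 * X := by
        have := Int.ediv_mul_le (2 * X : ℤ) (b := (idealNu J : ℕ)) (by exact_mod_cast hν.ne')
        exact_mod_cast this
      rw [le_div_iff₀ hν']
      exact h3
    calc (#F : ℝ) ≤ #((Ioc (-(X : ℤ) - 1) X).filter (fun m => m ≡ m₀ [ZMOD (idealNu J : ℕ)])) := by
          exact_mod_cast card_le_card hsub
      _ ≤ (((2 * X : ℤ) / (idealNu J : ℕ) + 1).toNat : ℝ) := by exact_mod_cast hcount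
      _ ≤ 2 * X / idealNu J + 1 := h2

open scoped Classical in
/-- **The count of p. 24**: `#{|m| ≤ X, |n| ≤ Y : m + nθ ∈ J} ≤ (2Y + 1)(2X/ν(J) + 1)` (`J ≠ 0`).
[cite: HeathBrownActa2001, §4 p. 24] -/
theorem card_box_filter_mem_le {J : Ideal (𝓞 K)} (hJ : J ≠ ⊥) (X Y : ℕ) :
    (#(((Icc (-(X : ℤ)) X) ×ˢ (Icc (-(Y : ℤ)) Y)).filter
        (fun v : ℤ × ℤ => (v.1 : 𝓞 K) + (v.2 : 𝓞 K) * θint ∈ J)) : ℝ) ≤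
      (2 * Y + 1) * (2 * X / idealNu J + 1) := by
  classical
  set S := ((Icc (-(X : ℤ)) X) ×ˢ (Icc (-(Y : ℤ)) Y)).filter
    (fun v : ℤ × ℤ => (v.1 : 𝓞 K) + (v.2 : 𝓞 K) * θint ∈ J) with hS
  have hmaps : ∀ v ∈ S, v.2 ∈ Icc (-(Y : ℤ)) Y := fun v hv =>
    (mem_product.mp (mem_filter.mp hv).1).2
  have hdecomp := card_eq_sum_card_fiberwise hmaps
  have hfib : ∀ n ∈ Icc (-(Y : ℤ)) Y, (#(S.filter (fun v => v.2 = n)) : ℝ) ≤ 2 * X / idealNu J + 1 := by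
    intro n _
    refine le_trans ?_ (card_filter_intCast_add_mul_mem_le hJ X n)
    have h : #(S.filter (fun v => v.2 = n)) ≤
        #((Icc (-(X : ℤ)) X).filter (fun m : ℤ => (m : 𝓞 K) + (n : 𝓞 K) * θint ∈ J)) := by
      refine card_le_card_of_injOn (fun v => v.1) ?_ ?_
      · intro v hv
        rw [mem_coe, mem_filter, hS, mem_filter, mem_product] at hv
        obtain ⟨⟨⟨h1, -⟩, hmem⟩, rfl⟩ := hv
        rw [mem_coe, mem_filter]
        exact ⟨h1, hmem⟩
      · intro v hv w hw hvw
        rw [mem_coe, mem_filter] at hv hw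
        exact Prod.ext hvw (hv.2.trans hw.2.symm)
    exact_mod_cast h
  calc (#S : ℝ) = ∑ n ∈ Icc (-(Y : ℤ)) Y, (#(S.filter (fun v => v.2 = n)) : ℝ) := by
        rw [hdecomp]; push_cast; rfl
    _ ≤ ∑ _n ∈ Icc (-(Y : ℤ)) Y, (2 * X / idealNu J + 1 : ℝ) := sum_le_sum hfib
    _ = (2 * Y + 1) * (2 * X / idealNu J + 1) := by
        rw [sum_const, nsmul_eq_mul, Int.card_Icc]
        congr 1
        rw [show ((Y : ℤ) + 1 - -(Y : ℤ)).toNat = 2 * Y + 1 by omega]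
        push_cast; ring

/-! ### Lemma 4.7 -/

/-- The element `m + nθ` is `coordElt (m, n, 0)`. [folklore] -/
theorem intCast_add_mul_θint_eq_coordElt (m n : ℤ) :
    (m : 𝓞 K) + (n : 𝓞 K) * θint = coordElt (m, n, 0) := by
  simp [coordElt]

open scoped Classical in
/-- **Heath-Brown's Lemma 4.7** (p. 25): "Let `x, y ≥ 2` be given. Then for any positive integer `A` there
exists a positive constant `c(A)` such that `∑_{|m| ≤ x, |n| ≤ y} τ(m + n·2^{1/3})^A ≪ xy (log xy)^{c(A)}`."
Here for integers `2 ≤ Y ≤ X` (`|m| ≤ X`, `|n| ≤ Y`; by the symmetry of the statement in the proof of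
Lemma 4.6 one may take `x ≥ y`), all `(m, n) ≠ (0, 0)`, `τ = idealDivisorCount` of the principal ideal
`(m + nθ)`, with a real exponent `e = e(A) ≥ 0`. [cite: HeathBrownActa2001, Lemma 4.7] -/
theorem HeathBrown2001_lemma_4_7 (A : ℕ) :
    ∃ C e : ℝ, 0 < C ∧ 0 ≤ e ∧ ∀ X Y : ℕ, 2 ≤ Y → Y ≤ X →
      ∑ v ∈ ((Icc (-(X : ℤ)) X) ×ˢ (Icc (-(Y : ℤ)) Y)).filter (· ≠ 0),
          (idealDivisorCount (Ideal.span {(v.1 : 𝓞 K) + (v.2 : 𝓞 K) * θint}) : ℝ) ^ A ≤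
        C * X * Y * Real.log ((X : ℝ) * Y) ^ e := by
  set c : ℕ := 23 * A with hc
  obtain ⟨C₁, e₁, hC₁, he₁, hν⟩ := exists_sum_nuWeight_le c
  obtain ⟨C₂, hC₂, h42⟩ := exists_sum_idealDivisorCount_pow_le c
  set e₂ : ℕ := 2 ^ (4 * c + 4) with he₂
  set E : ℝ := max e₁ e₂ with hE
  refine ⟨2 ^ (11 * A) * 3 * (2 * C₁ + C₂), E, by positivity, le_max_of_le_left he₁, ?_⟩
  intro X Y hY hYX
  have hX : 2 ≤ X := hY.trans hYX
  have hX' : (2 : ℝ) ≤ X := by exact_mod_cast hX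
  have hY' : (2 : ℝ) ≤ Y := by exact_mod_cast hY
  have hXpos : (0 : ℝ) < X := by linarith
  set Box := ((Icc (-(X : ℤ)) X) ×ˢ (Icc (-(Y : ℤ)) Y)).filter (· ≠ (0 : ℤ × ℤ)) with hBox
  set T := (idealsLE X).filter (· ≠ (⊥ : Ideal (𝓞 K))) with hT
  -- logs
  have hlogX : 0 < Real.log X := Real.log_pos (by linarith)
  have hlogXY1 : 1 ≤ Real.log ((X : ℝ) * Y) := by
    have h4 : (4 : ℝ) ≤ (X : ℝ) * Y := by nlinarith
    have : Real.log 4 ≤ Real.log ((X : ℝ) * Y) := Real.log_le_log (by norm_num) h4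
    have h2 : (1 : ℝ) ≤ Real.log 4 := by
      rw [show (4 : ℝ) = 2 ^ 2 by norm_num, Real.log_pow]
      have := Real.log_two_gt_d9; push_cast; linarith
    linarith
  have hlogX_le : Real.log X ≤ Real.log ((X : ℝ) * Y) :=
    Real.log_le_log hXpos (by nlinarith)
  have hpowX : ∀ {t : ℝ}, 0 ≤ t → t ≤ E → Real.log X ^ t ≤ Real.log ((X : ℝ) * Y) ^ E := by
    intro t ht htE
    calc Real.log X ^ t ≤ Real.log ((X : ℝ) * Y) ^ t := Real.rpow_le_rpow hlogX.le hlogX_le ht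
      _ ≤ Real.log ((X : ℝ) * Y) ^ E := Real.rpow_le_rpow_of_exponent_le hlogXY1 htE
  -- Step 1: pointwise bound via Lemma 4.4 with `n = 12`
  have hpt : ∀ v ∈ Box, (idealDivisorCount (Ideal.span {(v.1 : 𝓞 K) + (v.2 : 𝓞 K) * θint}) : ℝ) ^ A ≤
      2 ^ (11 * A) * ∑ J ∈ T.filter (fun J => (v.1 : 𝓞 K) + (v.2 : 𝓞 K) * θint ∈ J),
        (idealDivisorCount J : ℝ) ^ c := by
    intro v hv
    rw [hBox, mem_filter, mem_product, mem_Icc, mem_Icc] at hv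
    obtain ⟨⟨hm, hn⟩, hv0⟩ := hv
    set β : 𝓞 K := (v.1 : 𝓞 K) + (v.2 : 𝓞 K) * θint with hβ
    have hβcoord : β = coordElt (v.1, v.2, 0) := intCast_add_mul_θint_eq_coordElt v.1 v.2
    have hβ0 : β ≠ 0 := by
      intro h0
      rw [hβcoord] at h0
      have : (v.1, v.2, (0 : ℤ)) = 0 := coordElt_injective (h0.trans (by simp [coordElt]))
      apply hv0
      simp only [Prod.ext_iff, Prod.fst_zero, Prod.snd_zero] at this
      exact Prod.ext this.1 this.2.1
    have hI0 : Ideal.span {β} ≠ ⊥ := by rwa [Ne, Ideal.span_singleton_eq_bot]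
    -- `N((β)) ≤ 512 X³ ≤ X^{12}`
    have hnorm : (Ideal.absNorm (Ideal.span {β}) : ℝ) ≤ (X : ℝ) ^ 12 := by
      have h1 := absNorm_span_coordElt_le (v.1, v.2, 0)
      rw [← hβcoord] at h1
      simp only [Int.cast_zero, abs_zero, add_zero] at h1
      have hm' : |(v.1 : ℝ)| ≤ X := by
        rw [abs_le]; constructor <;> exact_mod_cast (by omega : _) 
      have hn' : |(v.2 : ℝ)| ≤ X := by
        rw [abs_le]; constructor <;> exact_mod_cast (by omega : _)
      calc (Ideal.absNorm (Ideal.span {β}) : ℝ) ≤ 64 * (|(v.1 : ℝ)| + |(v.2 : ℝ)|) ^ 3 := h1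
        _ ≤ 64 * ((X : ℝ) + X) ^ 3 := by gcongr
        _ = 512 * (X : ℝ) ^ 3 := by ring
        _ ≤ (X : ℝ) ^ 9 * (X : ℝ) ^ 3 := by
            gcongr
            calc (512 : ℝ) = 2 ^ 9 := by norm_num
              _ ≤ (X : ℝ) ^ 9 := pow_le_pow_left₀ (by norm_num) hX' 9
        _ = (X : ℝ) ^ 12 := by ring
    obtain ⟨J, hJdvd, hJnorm, hτ⟩ := HeathBrown2001_lemma_4_4 (n := 12) (by norm_num) hI0
    have hJ0 : J ≠ ⊥ := by rintro rfl; exact hI0 (zero_dvd_iff.mp hJdvd)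
    have hJX : Ideal.absNorm J ≤ X := by
      have h1 : (Ideal.absNorm J : ℝ) ≤ X := by
        refine hJnorm.trans ?_
        calc (Ideal.absNorm (Ideal.span {β}) : ℝ) ^ ((12 : ℕ) : ℝ)⁻¹ ≤ ((X : ℝ) ^ 12) ^ ((12 : ℕ) : ℝ)⁻¹ :=
              Real.rpow_le_rpow (by positivity) hnorm (by positivity)
          _ = X := by
              rw [← Real.rpow_natCast, ← Real.rpow_mul hXpos.le]; norm_num
      exact_mod_cast Nat.le_floor h1 |>.trans (Nat.floor_natCast X).le
    have hJT : J ∈ T.filter (fun J => β ∈ J) := by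
      rw [mem_filter, hT, mem_filter, mem_idealsLE]
      exact ⟨⟨hJX, hJ0⟩, Ideal.dvd_span_singleton.mp hJdvd⟩
    have hτR : (idealDivisorCount (Ideal.span {β}) : ℝ) ≤ 2 ^ 11 * (idealDivisorCount J : ℝ) ^ 23 := by
      exact_mod_cast hτ
    calc (idealDivisorCount (Ideal.span {β}) : ℝ) ^ A ≤ (2 ^ 11 * (idealDivisorCount J : ℝ) ^ 23) ^ A :=
          pow_le_pow_left₀ (by positivity) hτR A
      _ = 2 ^ (11 * A) * (idealDivisorCount J : ℝ) ^ c := by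
          rw [mul_pow, ← pow_mul, ← pow_mul, hc]
      _ ≤ 2 ^ (11 * A) * ∑ J' ∈ T.filter (fun J => β ∈ J), (idealDivisorCount J' : ℝ) ^ c := by
          refine mul_le_mul_of_nonneg_left ?_ (by positivity)
          exact single_le_sum (f := fun J' => (idealDivisorCount J' : ℝ) ^ c)
            (fun J' _ => by positivity) hJT
  -- Step 2: sum over the box and swap
  have hswap : ∑ v ∈ Box, ∑ J ∈ T.filter (fun J => (v.1 : 𝓞 K) + (v.2 : 𝓞 K) * θint ∈ J),
      (idealDivisorCount J : ℝ) ^ c =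
      ∑ J ∈ T, (idealDivisorCount J : ℝ) ^ c *
        #(Box.filter (fun v => (v.1 : 𝓞 K) + (v.2 : 𝓞 K) * θint ∈ J)) := by
    simp only [sum_filter]
    rw [sum_comm]
    refine sum_congr rfl fun J _ => ?_
    rw [← sum_filter, sum_const, nsmul_eq_mul, mul_comm]
  -- Step 3: the count
  have hcount : ∀ J ∈ T, (#(Box.filter (fun v => (v.1 : 𝓞 K) + (v.2 : 𝓞 K) * θint ∈ J)) : ℝ) ≤
      (2 * Y + 1) * (2 * X / idealNu J + 1) := by
    intro J hJ
    have hJ0 : J ≠ ⊥ := (mem_filter.mp hJ).2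
    refine le_trans ?_ (card_box_filter_mem_le hJ0 X Y)
    exact_mod_cast card_le_card (fun v hv => by
      rw [mem_filter] at hv ⊢
      exact ⟨(mem_filter.mp hv.1).1, hv.2⟩)
  -- Step 4: the two divisor sums
  have hsum1 := hν X hX
  have hsum2 := h42 X hX
  have hνpos : ∀ J ∈ T, (0 : ℝ) < idealNu J := fun J hJ => by
    exact_mod_cast idealNu_pos (mem_filter.mp hJ).2
  -- assemble
  calc ∑ v ∈ Box, (idealDivisorCount (Ideal.span {(v.1 : 𝓞 K) + (v.2 : 𝓞 K) * θint}) : ℝ) ^ A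
      ≤ ∑ v ∈ Box, 2 ^ (11 * A) * ∑ J ∈ T.filter (fun J => (v.1 : 𝓞 K) + (v.2 : 𝓞 K) * θint ∈ J),
          (idealDivisorCount J : ℝ) ^ c := sum_le_sum hpt
    _ = 2 ^ (11 * A) * ∑ J ∈ T, (idealDivisorCount J : ℝ) ^ c *
          #(Box.filter (fun v => (v.1 : 𝓞 K) + (v.2 : 𝓞 K) * θint ∈ J)) := by
        rw [← mul_sum, hswap]
    _ ≤ 2 ^ (11 * A) * ∑ J ∈ T, (idealDivisorCount J : ℝ) ^ c * ((2 * Y + 1) * (2 * X / idealNu J + 1)) := by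
        gcongr with J hJ
        exact hcount J hJ
    _ = 2 ^ (11 * A) * (2 * Y + 1) * (2 * X * ∑ J ∈ T, (idealDivisorCount J : ℝ) ^ c / idealNu J +
          ∑ J ∈ T, (idealDivisorCount J : ℝ) ^ c) := by
        have key : (2 * Y + 1 : ℝ) * (2 * X * ∑ J ∈ T, (idealDivisorCount J : ℝ) ^ c / idealNu J +
            ∑ J ∈ T, (idealDivisorCount J : ℝ) ^ c) =
            ∑ J ∈ T, (idealDivisorCount J : ℝ) ^ c * ((2 * Y + 1) * (2 * X / idealNu J + 1)) := by
          rw [mul_add, ← mul_assoc, mul_sum, mul_sum, ← sum_add_distrib]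
          refine sum_congr rfl fun J hJ => ?_
          have := hνpos J hJ
          field_simp
        rw [mul_assoc, key]
    _ ≤ 2 ^ (11 * A) * (3 * Y) * (2 * X * (C₁ * Real.log X ^ e₁) + C₂ * X * Real.log X ^ e₂) := by
        have h3 : (2 * Y + 1 : ℝ) ≤ 3 * Y := by linarith
        have hS0 : 0 ≤ 2 * X * ∑ J ∈ T, (idealDivisorCount J : ℝ) ^ c / idealNu J +
            ∑ J ∈ T, (idealDivisorCount J : ℝ) ^ c := by positivity
        gcongr
    _ ≤ 2 ^ (11 * A) * (3 * Y) * (2 * X * (C₁ * Real.log ((X : ℝ) * Y) ^ E) +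
          C₂ * X * Real.log ((X : ℝ) * Y) ^ E) := by
        gcongr
        · exact hpowX he₁ (le_max_left _ _)
        · rw [← Real.rpow_natCast]
          exact hpowX (by positivity) (by rw [hE, he₂]; exact_mod_cast le_max_right _ _)
    _ = 2 ^ (11 * A) * 3 * (2 * C₁ + C₂) * X * Y * Real.log ((X : ℝ) * Y) ^ E := by ring

end Literature.NumberTheory.Sieve.CubicSieve

end
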